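import Summits.BirchSwinnertonDyer.Rank1Residual.Supersingular.SignedSqueezeX7
import Literature.NumberTheory.EllipticCurves.Wuthrich2014.ThreeAdicImageSupersingularProofs
import Summits.BirchSwinnertonDyer.BirchSwinnertonDyer.Theorems.PrintX8SmallImageMuReading
import Literature.NumberTheory.EllipticCurves.Sprung2012.SharpFlatColemanKatoContragredient
import Literature.NumberTheory.EllipticCurves.Sprung2012.SharpFlatSelmerDualInvolutionTwistProofs
import HarnessLib

/-!
# Route `PrintX8VSC` (print-keyed twin of `PrintX8VS`), glue item `GlueSharpFlatMainConjectureOfKatoSporadicX8Contra`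
# (stmt-BirchSwinnertonDyer-23743) — PART 2a, per datum: the Eisenstein half in PRINT keying + Kato's half in PRINT keying
# (`thm716_sharpFlatCharIdeal_divisibility_contra`) pin `char X^•(E/ℚ_∞)` to `(3^m · L^•_3(E))`; `m = 0` under `surj(3)`
# (Wuthrich 2014 Lemma 20) or under the `μ`-inequality `μ(X^•) ≤ μ(Λ/(L^•))`

Cell `bsd-ssimc`, width seat `cruxlead-stmt-BirchSwinnertonDyer-19875-w2` (gen 11) under the 19875 LEAD; `--supports`
stmt-BirchSwinnertonDyer-23743; THEOREMS ONLY; route-independent (no `Theses.PrintX8VSC` import). HONEST FRAMING: this is the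
token-for-token PORT to the contragredient (`γ⁻¹`-keyed, printed) ♯/♭ dual datum
`D : SharpFlatSelmerDualData W κ γ⁻¹ …` of three landed per-pair criteria of route `PrintX8`/`PrintX8VS`:
`X8.sprungSharpFlatMainConjecture_of_lowerDivisibility_of_surj` (`…SprungLowerDivisibilityAtThreeSurjBranch`, p534029),
`PrintX8MuReading.X8.exists_charIdeal_eq_span_pow_mul_of_lowerDivisibility` and
`PrintX8MuReading.X8.sprungSharpFlatMainConjecture_of_lowerDivisibility_of_muInvariant_le` (`PrintX8SmallImageMuReading`).
The ONLY changes: the dual datum is keyed by `γ⁻¹`, Kato's half is the print-keyed named fact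
`Sprung2012.thm716_sharpFlatCharIdeal_divisibility_contra` (p662311; its `.of_thm714` form discharges the torsion
hypotheses from the keying-immune Thm. 7.14), and the statements are PER DATUM (the Eisenstein half enters as the
displayed hypothesis `hK1D` on the one datum `D`, the shape produced by the C′ bricks
`ChromaticCommonZeros.squeezeToCommonZeros_contra` / `sprungSharpFlatLowerDivisibilityContra_of_noCommonZero`, p668614).
No new mathematics; nothing here is a theorem beyond print; the main conjecture at `a₃ = ±3`, K′, C′, leaf X8 and BSD are
NOT proved. Referee N-287b honoured: no `γ`-keyed fact is instantiated at `γ⁻¹` (Thm. 7.14 is instantiated at key `γ`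
on an auxiliary datum `D₀` and transported by the PROVED dictionary `sharpFlatSelmerDualData_{finite,isTorsion}_inv_iff`).

* §1 `exists_charIdeal_eq_span_pow_mul_of_lowerDivisibilityContra` — `hK1D` (`char D.X = (gen)`, `gen^ℚ = ϖ·(L^•·h)^ℚ`)
  + Thm. 7.14 + Thm. 7.16-contra (first clause, NO image hypothesis) + period unit ⟹ `D.X` f.g. torsion and
  `char D.X = (p^m · L^•)` for some `m`; `μ(D.X) = m + μ(Λ/(L^•))`.
* §2 `sharpFlatMainConjectureContra_of_lowerDivisibilityContra_of_surj` — on `surj(3)` the second clause of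
  Thm. 7.16-contra (`n = 0`, `3`-adic surjectivity by Wuthrich 2014 Lemma 20) gives `m = 0`: the print-keyed main
  identity `char D.X = (gen′)`, `gen′^ℚ = ϖ·L^•^ℚ` (the per-datum body of `PrintX8VSC.SharpFlatMainConjectureX8Contra`).
* §3 `sharpFlatMainConjectureContra_of_lowerDivisibilityContra_of_muInvariant_le` — at ANY image, the displayed
  `μ`-inequality `μ(D.X) ≤ μ(Λ/(L^•))` forces `m = 0`.

References: [Sprung2012] Thm. 1.2/7.14, Thm. 1.4/7.16 (pp. 1486, 1504), Main Conj. 7.21 (p. 1505), §7.5 l.1 (the printed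
dual `𝒳^•* = X^•(γ⁻¹)`); [Wuthrich2014] Lemma 20 (p. 399); [Washington1997] §13.2; [GreenbergLNM1716] §1 (p. 60) (`S^ι`).
-/

set_option autoImplicit false
-- justification: the mandated namespace `Summit.BirchSwinnertonDyer.BirchSwinnertonDyer.Theorems`
-- (single-conjunct summit, Sub = Summit) repeats a segment by design (D-0017).
set_option linter.dupNamespace false

noncomputable section

open scoped Classical NumberField MatrixGroups ModularForm
open NumberField IsDedekindDomain WeierstrassCurve CongruenceSubgroup
  Literature.NumberTheory.EllipticCurves Literature.NumberTheory.EllipticCurves.ModularForms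
  Literature.NumberTheory.EllipticCurves.Rank1Residual
  Literature.NumberTheory.EllipticCurves.Sprung2017 Literature.NumberTheory.EllipticCurves.Sprung2012
  Literature.NumberTheory.EllipticCurves.ZpExtension Literature.NumberTheory.EllipticCurves.IwasawaAlgebra
  Summit.BirchSwinnertonDyer.Rank1Residual.Supersingular
  Summit.BirchSwinnertonDyer.BirchSwinnertonDyer.Theorems

namespace Summit.BirchSwinnertonDyer.BirchSwinnertonDyer.Theorems.X8MainConjectureContra

section PerDatum

variable (W : WeierstrassCurve ℚ) [W.IsElliptic] [W.IsGloballyMinimal] (p : ℕ) [Fact p.Prime]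

/-! ### §1 Print keying, ANY image: the Eisenstein half on a contragredient datum pins `char X^•` to `(p^m · L^•)` -/

/-- **X8, ANY image, colour `•`, ONE contragredient datum `D` of `Sel^•(E/ℚ_∞)` (key `γ⁻¹`, the printed `𝒳^•*`):
the Eisenstein half on `D` (`char D.X = (gen)`, `gen^ℚ = ϖ·(L^•·h)^ℚ`) ⟹ `D.X` is finitely generated `Λ`-torsion and
`char D.X = (p^m · L^•_p(E))` for some `m`.** Inputs BY NAME: Sprung 2012 Thm. 7.14 (`h714`, keying-immune: instantiated
at key `γ` on an auxiliary datum and transported by `sharpFlatSelmerDualData_{finite,isTorsion}_inv_iff`), Thm. 7.16 in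
PRINT keying, FIRST clause (`h716c.exists_dvd_pow_mul`: `gen ∣ pⁿ·L^•`, NO image hypothesis), the period unit at `3`
(`h3`: `ϖ ∈ ℤ₃ˣ`). Then `L^•·h ∣ pⁿ·L^•`, `h ∼ p^m` (`PrintX8MuReading.span_eq_span_pow_mul_of_dvd_pow_mul`). Port of
`PrintX8MuReading.X8.exists_charIdeal_eq_span_pow_mul_of_lowerDivisibility`. PER DATUM; conditional on `hK1D`; closes
nothing. [cite: Sprung2012, Thm. 7.14 and Thm. 7.16 (p. 1504)] [cite: Washington1997, §13.2] [cite: GreenbergLNM1716, §1 (p. 60)] -/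
theorem exists_charIdeal_eq_span_pow_mul_of_lowerDivisibilityContra
    (h714 : thm714_sharpFlatSelmerDual_finite_torsion)
    (h716c : thm716_sharpFlatCharIdeal_divisibility_contra)
    (h3 : realPeriodRat_eq_unit_mul_plusPeriod_three)
    (hX : ClassX8 W p) (col : Chroma)
    {κ : ZpExtension ℚ p} {γ : Field.absoluteGaloisGroup ℚ} (hκ : κ.IsCyclotomic)
    (hγ : κ.IsTopGenerator γ) (hγ' : IsCyclotomicVariable p γ)
    {v : HeightOneSpectrum (𝓞 ℚ)} (hv : (p : 𝓞 ℚ) ∈ v.asIdeal)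
    {g : Field.absoluteGaloisGroup (v.adicCompletion ℚ)}
    (hg : κ.IsTopGenerator (resGalOfEmb (closureEmb (K := ℚ) (v.adicCompletion ℚ)) g))
    {cneg : localPoints W (v.adicCompletion ℚ)} {c : ℕ → localPoints W (v.adicCompletion ℚ)}
    (hc : IsHondaSystem κ (closureEmb (K := ℚ) (v.adicCompletion ℚ)) W (W.frobeniusTrace p) g cneg c)
    {N : ℕ} [hN : NeZero N] {f : CuspForm (Gamma0 N) 2} {ϖ : ℚ} {Lsharp Lflat : IwasawaAlgebra p}
    (hf : IsNewformOf W f) (hϖ : (ϖ : ℝ) * W.realPeriodRat = plusPeriod f)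
    (hSP : IsSprungPair f p (W.frobeniusTrace p) Lsharp Lflat)
    (hcol : chromaticL col Lsharp Lflat ≠ 0)
    (D : SharpFlatSelmerDualData W κ γ⁻¹ (closureEmb (K := ℚ) (v.adicCompletion ℚ))
      (W.frobeniusTrace p) g c col)
    (hK1D : ∃ gen h : IwasawaAlgebra p, D.charIdeal = Ideal.span {gen} ∧
      iwasawaToPowerSeries p gen =
        PowerSeries.C (ϖ : ℚ_[p]) * iwasawaToPowerSeries p (chromaticL col Lsharp Lflat * h)) :
    Module.IsTorsion (IwasawaAlgebra p) D.X ∧ Module.Finite (IwasawaAlgebra p) D.X ∧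
      ∃ m : ℕ, D.charIdeal =
        Ideal.span {(p : IwasawaAlgebra p) ^ m * chromaticL col Lsharp Lflat} := by
  have hp3 : p = 3 := hX.1
  subst hp3
  have hp2 : (3 : ℕ) ≠ 2 := by decide
  have hgood : W.HasGoodReductionAtPrime 3 := hX.2.1.1
  have hdvd : ((3 : ℕ) : ℤ) ∣ W.frobeniusTrace 3 := hX.2.1.2
  -- Sprung 2012 Thm. 7.14 (keying-immune) at key `γ`, transported to the contragredient datum
  obtain ⟨D₀⟩ := nonempty_sharpFlatSelmerDualData_rat W κ γ v g c col
  obtain ⟨hfin₀, htor₀⟩ :=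
    h714 W 3 hp2 hgood hdvd f hf κ γ hκ hγ hγ' v hv g hg cneg c hc col Lsharp Lflat hSP hcol D₀
  haveI := hfin₀
  haveI hfinD : Module.Finite (IwasawaAlgebra 3) D.X := (sharpFlatSelmerDualData_finite_inv_iff D₀ D).1 hfin₀
  have htorD : Module.IsTorsion (IwasawaAlgebra 3) D.X := (sharpFlatSelmerDualData_isTorsion_inv_iff D₀ D).1 htor₀
  -- the Eisenstein half on `D`
  obtain ⟨gen, h, hchar, hι⟩ := hK1D
  -- Kato in print keying (Sprung 2012 Thm. 7.16, FIRST clause, no image hypothesis): `gen ∣ 3ⁿ · L^•`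
  obtain ⟨n, hn⟩ :=
    h716c.exists_dvd_pow_mul hp2 hgood hdvd hf hκ hγ hγ' hv hg hc hSP hcol D htorD hchar
  -- `ϖ ∈ ℤ₃ˣ`
  have hϖ1 : ‖(ϖ : ℚ_[3])‖ = 1 := X8_norm_periodRatio_eq_one h3 W 3 hX hf hϖ
  obtain ⟨-, hι'⟩ := span_C_units_mul_eq (PadicInt.mkUnits hϖ1) (chromaticL col Lsharp Lflat * h)
  have hgen_eq : gen = PowerSeries.C ((PadicInt.mkUnits hϖ1 : ℤ_[3]ˣ) : ℤ_[3]) *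
      (chromaticL col Lsharp Lflat * h) := by
    apply iwasawaToPowerSeries_injective 3
    rw [hι, hι', PadicInt.mkUnits_eq]
  obtain ⟨m, -, hspan⟩ :=
    PrintX8MuReading.span_eq_span_pow_mul_of_dvd_pow_mul (PadicInt.mkUnits hϖ1) hcol hgen_eq hn
  exact ⟨htorD, hfinD, m, hchar.trans hspan⟩

/-- **The `μ`-count, print keying**: for the contragredient datum `D` with the Eisenstein half, `char D.X = (p^m · L^•)`
with `μ(D.X) = m + μ(Λ/(L^•))` — the Eisenstein half is the `μ`-LOWER bound and `m` is the whole residual. Port of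
`PrintX8MuReading.X8.exists_charIdeal_eq_and_muInvariant_eq_of_lowerDivisibility`. PER DATUM; conditional.
[cite: Sprung2012, Thm. 7.14 and Thm. 7.16 (p. 1504)] [cite: Washington1997, §13.2] -/
theorem exists_charIdeal_eq_and_muInvariant_eq_of_lowerDivisibilityContra
    (h714 : thm714_sharpFlatSelmerDual_finite_torsion)
    (h716c : thm716_sharpFlatCharIdeal_divisibility_contra)
    (h3 : realPeriodRat_eq_unit_mul_plusPeriod_three)
    (hX : ClassX8 W p) (col : Chroma)
    {κ : ZpExtension ℚ p} {γ : Field.absoluteGaloisGroup ℚ} (hκ : κ.IsCyclotomic)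
    (hγ : κ.IsTopGenerator γ) (hγ' : IsCyclotomicVariable p γ)
    {v : HeightOneSpectrum (𝓞 ℚ)} (hv : (p : 𝓞 ℚ) ∈ v.asIdeal)
    {g : Field.absoluteGaloisGroup (v.adicCompletion ℚ)}
    (hg : κ.IsTopGenerator (resGalOfEmb (closureEmb (K := ℚ) (v.adicCompletion ℚ)) g))
    {cneg : localPoints W (v.adicCompletion ℚ)} {c : ℕ → localPoints W (v.adicCompletion ℚ)}
    (hc : IsHondaSystem κ (closureEmb (K := ℚ) (v.adicCompletion ℚ)) W (W.frobeniusTrace p) g cneg c)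
    {N : ℕ} [hN : NeZero N] {f : CuspForm (Gamma0 N) 2} {ϖ : ℚ} {Lsharp Lflat : IwasawaAlgebra p}
    (hf : IsNewformOf W f) (hϖ : (ϖ : ℝ) * W.realPeriodRat = plusPeriod f)
    (hSP : IsSprungPair f p (W.frobeniusTrace p) Lsharp Lflat)
    (hcol : chromaticL col Lsharp Lflat ≠ 0)
    (D : SharpFlatSelmerDualData W κ γ⁻¹ (closureEmb (K := ℚ) (v.adicCompletion ℚ))
      (W.frobeniusTrace p) g c col)
    (hK1D : ∃ gen h : IwasawaAlgebra p, D.charIdeal = Ideal.span {gen} ∧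
      iwasawaToPowerSeries p gen =
        PowerSeries.C (ϖ : ℚ_[p]) * iwasawaToPowerSeries p (chromaticL col Lsharp Lflat * h)) :
    ∃ m : ℕ, D.charIdeal = Ideal.span {(p : IwasawaAlgebra p) ^ m * chromaticL col Lsharp Lflat} ∧
      muInvariant p D.X =
        m + muInvariant p (IwasawaAlgebra p ⧸ Ideal.span {chromaticL col Lsharp Lflat}) := by
  obtain ⟨htorD, hfinD, m, hm⟩ := exists_charIdeal_eq_span_pow_mul_of_lowerDivisibilityContra W p h714 h716c
    h3 hX col hκ hγ hγ' hv hg hc hf hϖ hSP hcol D hK1D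
  haveI := hfinD
  exact ⟨m, hm, PrintX8MuReading.muInvariant_eq_add_of_charIdeal_eq_span_pow_mul D.X htorD hcol hm⟩

/-! ### §2 Big image: `m = 0` by the integral clause of Thm. 7.16-contra (Wuthrich 2014 Lemma 20 for `3`-adic surjectivity) -/

/-- **X8 ∧ `surj(3)`, ANY analytic rank, colour `•`, ONE contragredient datum `D`: the Eisenstein half on `D` ⟹ the
print-keyed ♯/♭ main identity on `D`** — `D.X` is `Λ`-torsion and `char D.X = (gen′)` with `gen′^ℚ = ϖ·L^•^ℚ` (the
per-datum body of `PrintX8VSC.SharpFlatMainConjectureX8Contra`; Sprung's Main Conj. 7.21 AS PRINTED, Néron-normalised).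
`Λ`-rigidity: `L^• ∣ gen` (`hK1D`, `ϖ ∈ ℤ₃ˣ`) and `gen ∣ L^•` (Thm. 7.16-contra, SECOND clause `n = 0`, the `3`-adic
surjectivity from `surj(3)` by Wuthrich 2014 Lemma 20 — a kernel theorem at the good prime `3`,
`surjective_pow_of_surj_of_good`). Port of `X8.sprungSharpFlatMainConjecture_of_lowerDivisibility_of_surj` (p534029).
PER DATUM; conditional on `hK1D`; closes nothing. [cite: Sprung2012, Thm. 7.14, Thm. 7.16 and Main Conj. 7.21 (pp. 1504–1505)]
[cite: Wuthrich2014, Lemma 20 (p. 399)] [cite: Washington1997, §13.2] -/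
theorem sharpFlatMainConjectureContra_of_lowerDivisibilityContra_of_surj
    (h714 : thm714_sharpFlatSelmerDual_finite_torsion)
    (h716c : thm716_sharpFlatCharIdeal_divisibility_contra)
    (h3 : realPeriodRat_eq_unit_mul_plusPeriod_three)
    (hX : ClassX8 W p) (hs : Surj W p) (col : Chroma)
    {κ : ZpExtension ℚ p} {γ : Field.absoluteGaloisGroup ℚ} (hκ : κ.IsCyclotomic)
    (hγ : κ.IsTopGenerator γ) (hγ' : IsCyclotomicVariable p γ)
    {v : HeightOneSpectrum (𝓞 ℚ)} (hv : (p : 𝓞 ℚ) ∈ v.asIdeal)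
    {g : Field.absoluteGaloisGroup (v.adicCompletion ℚ)}
    (hg : κ.IsTopGenerator (resGalOfEmb (closureEmb (K := ℚ) (v.adicCompletion ℚ)) g))
    {cneg : localPoints W (v.adicCompletion ℚ)} {c : ℕ → localPoints W (v.adicCompletion ℚ)}
    (hc : IsHondaSystem κ (closureEmb (K := ℚ) (v.adicCompletion ℚ)) W (W.frobeniusTrace p) g cneg c)
    {N : ℕ} [hN : NeZero N] {f : CuspForm (Gamma0 N) 2} {ϖ : ℚ} {Lsharp Lflat : IwasawaAlgebra p}
    (hf : IsNewformOf W f) (hϖ : (ϖ : ℝ) * W.realPeriodRat = plusPeriod f)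
    (hSP : IsSprungPair f p (W.frobeniusTrace p) Lsharp Lflat)
    (hcol : chromaticL col Lsharp Lflat ≠ 0)
    (D : SharpFlatSelmerDualData W κ γ⁻¹ (closureEmb (K := ℚ) (v.adicCompletion ℚ))
      (W.frobeniusTrace p) g c col)
    (hK1D : ∃ gen h : IwasawaAlgebra p, D.charIdeal = Ideal.span {gen} ∧
      iwasawaToPowerSeries p gen =
        PowerSeries.C (ϖ : ℚ_[p]) * iwasawaToPowerSeries p (chromaticL col Lsharp Lflat * h)) :
    Module.IsTorsion (IwasawaAlgebra p) D.X ∧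
      ∃ gen : IwasawaAlgebra p, D.charIdeal = Ideal.span {gen} ∧
        iwasawaToPowerSeries p gen =
          PowerSeries.C (ϖ : ℚ_[p]) * iwasawaToPowerSeries p (chromaticL col Lsharp Lflat) := by
  have hp3 : p = 3 := hX.1
  subst hp3
  have hp2 : (3 : ℕ) ≠ 2 := by decide
  have hgood : W.HasGoodReductionAtPrime 3 := hX.2.1.1
  have hdvd : ((3 : ℕ) : ℤ) ∣ W.frobeniusTrace 3 := hX.2.1.2
  -- Sprung 2012 Thm. 7.14 (keying-immune) at key `γ`, transported to the contragredient datum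
  obtain ⟨D₀⟩ := nonempty_sharpFlatSelmerDualData_rat W κ γ v g c col
  obtain ⟨hfin₀, htor₀⟩ :=
    h714 W 3 hp2 hgood hdvd f hf κ γ hκ hγ hγ' v hv g hg cneg c hc col Lsharp Lflat hSP hcol D₀
  haveI := hfin₀
  haveI hfinD : Module.Finite (IwasawaAlgebra 3) D.X := (sharpFlatSelmerDualData_finite_inv_iff D₀ D).1 hfin₀
  have htorD : Module.IsTorsion (IwasawaAlgebra 3) D.X := (sharpFlatSelmerDualData_isTorsion_inv_iff D₀ D).1 htor₀
  -- the Eisenstein half on `D`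
  obtain ⟨gen, h, hchar, hι⟩ := hK1D
  -- Kato in print keying (Sprung 2012 Thm. 7.16, `n = 0`): `gen ∣ L^•`; `3`-adic surjectivity from `surj(3)`
  have hsurj : ∀ n : ℕ, W.HasSurjectiveModNGaloisRep (3 ^ n : ℕ) :=
    surjective_pow_of_surj_of_good W 3 Wuthrich2014.lemma20_surjective_threeAdic_of_semistable_holds
      hp2 hgood hs
  have hKato : gen ∣ chromaticL col Lsharp Lflat :=
    h716c.dvd_of_charIdeal_eq_span hp2 hgood hdvd hf hκ hγ hγ' hv hg hc hSP hcol D htorD hsurj hchar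
  -- `ϖ ∈ ℤ_3^×`, so `L^• ∣ gen`
  have hϖ1 : ‖(ϖ : ℚ_[3])‖ = 1 := X8_norm_periodRatio_eq_one h3 W 3 hX hf hϖ
  obtain ⟨-, hι'⟩ := span_C_units_mul_eq (PadicInt.mkUnits hϖ1) (chromaticL col Lsharp Lflat * h)
  have hgen_eq : gen = PowerSeries.C ((PadicInt.mkUnits hϖ1 : ℤ_[3]ˣ) : ℤ_[3]) *
      (chromaticL col Lsharp Lflat * h) := by
    apply iwasawaToPowerSeries_injective 3
    rw [hι, hι', PadicInt.mkUnits_eq]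
  have hLgen : chromaticL col Lsharp Lflat ∣ gen :=
    ⟨PowerSeries.C ((PadicInt.mkUnits hϖ1 : ℤ_[3]ˣ) : ℤ_[3]) * h, by rw [hgen_eq]; ring⟩
  have hspan : Ideal.span ({gen} : Set (IwasawaAlgebra 3)) =
      Ideal.span {chromaticL col Lsharp Lflat} :=
    Ideal.span_singleton_eq_span_singleton.mpr (associated_of_dvd_dvd hKato hLgen)
  -- the Néron-normalised generator `ϖ̃ · L^•`
  obtain ⟨hspan', hι''⟩ := span_C_units_mul_eq (PadicInt.mkUnits hϖ1) (chromaticL col Lsharp Lflat)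
  refine ⟨htorD, PowerSeries.C ((PadicInt.mkUnits hϖ1 : ℤ_[3]ˣ) : ℤ_[3]) *
    chromaticL col Lsharp Lflat, ?_, ?_⟩
  · rw [hchar, hspan, hspan']
  · rw [hι'', PadicInt.mkUnits_eq]

/-! ### §3 Any image: `m = 0` by the `μ`-inequality -/

/-- **X8, ANY image, colour `•`, ONE contragredient datum `D`: the Eisenstein half on `D` + `μ(D.X) ≤ μ(Λ/(L^•))` ⟹ the
print-keyed ♯/♭ main identity on `D`** (`char D.X = (p^m L^•)` and `μ(D.X) = m + μ(Λ/(L^•))` by §1, so the inequality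
forces `m = 0`). The `μ`-hypothesis is `ϖ`-free and — `(p)` being `ι`-fixed — keying-immune
(`sharpFlatSelmerDualData_mu_inv_eq`). Inputs BY NAME: Thm. 7.14, Thm. 7.16-contra (first clause), period unit at `3`. Port
of `PrintX8MuReading.X8.sprungSharpFlatMainConjecture_of_lowerDivisibility_of_muInvariant_le`. PER DATUM; conditional on
`hK1D` and the displayed `μ`-bound; closes nothing. [cite: Sprung2012, Thm. 7.14, Thm. 7.16 (p. 1504) and Main Conj. 7.21 (p. 1505)]
[cite: Washington1997, §13.2] -/
theorem sharpFlatMainConjectureContra_of_lowerDivisibilityContra_of_muInvariant_le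
    (h714 : thm714_sharpFlatSelmerDual_finite_torsion)
    (h716c : thm716_sharpFlatCharIdeal_divisibility_contra)
    (h3 : realPeriodRat_eq_unit_mul_plusPeriod_three)
    (hX : ClassX8 W p) (col : Chroma)
    {κ : ZpExtension ℚ p} {γ : Field.absoluteGaloisGroup ℚ} (hκ : κ.IsCyclotomic)
    (hγ : κ.IsTopGenerator γ) (hγ' : IsCyclotomicVariable p γ)
    {v : HeightOneSpectrum (𝓞 ℚ)} (hv : (p : 𝓞 ℚ) ∈ v.asIdeal)
    {g : Field.absoluteGaloisGroup (v.adicCompletion ℚ)}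
    (hg : κ.IsTopGenerator (resGalOfEmb (closureEmb (K := ℚ) (v.adicCompletion ℚ)) g))
    {cneg : localPoints W (v.adicCompletion ℚ)} {c : ℕ → localPoints W (v.adicCompletion ℚ)}
    (hc : IsHondaSystem κ (closureEmb (K := ℚ) (v.adicCompletion ℚ)) W (W.frobeniusTrace p) g cneg c)
    {N : ℕ} [hN : NeZero N] {f : CuspForm (Gamma0 N) 2} {ϖ : ℚ} {Lsharp Lflat : IwasawaAlgebra p}
    (hf : IsNewformOf W f) (hϖ : (ϖ : ℝ) * W.realPeriodRat = plusPeriod f)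
    (hSP : IsSprungPair f p (W.frobeniusTrace p) Lsharp Lflat)
    (hcol : chromaticL col Lsharp Lflat ≠ 0)
    (D : SharpFlatSelmerDualData W κ γ⁻¹ (closureEmb (K := ℚ) (v.adicCompletion ℚ))
      (W.frobeniusTrace p) g c col)
    (hK1D : ∃ gen h : IwasawaAlgebra p, D.charIdeal = Ideal.span {gen} ∧
      iwasawaToPowerSeries p gen =
        PowerSeries.C (ϖ : ℚ_[p]) * iwasawaToPowerSeries p (chromaticL col Lsharp Lflat * h))
    (hμ : muInvariant p D.X ≤ muInvariant p (IwasawaAlgebra p ⧸ Ideal.span {chromaticL col Lsharp Lflat})) :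
    Module.IsTorsion (IwasawaAlgebra p) D.X ∧
      ∃ gen : IwasawaAlgebra p, D.charIdeal = Ideal.span {gen} ∧
        iwasawaToPowerSeries p gen =
          PowerSeries.C (ϖ : ℚ_[p]) * iwasawaToPowerSeries p (chromaticL col Lsharp Lflat) := by
  obtain ⟨htorD, hfinD, m, hm⟩ := exists_charIdeal_eq_span_pow_mul_of_lowerDivisibilityContra W p h714 h716c
    h3 hX col hκ hγ hγ' hv hg hc hf hϖ hSP hcol D hK1D
  haveI := hfinD
  have hμm : muInvariant p D.X =
      m + muInvariant p (IwasawaAlgebra p ⧸ Ideal.span {chromaticL col Lsharp Lflat}) :=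
    PrintX8MuReading.muInvariant_eq_add_of_charIdeal_eq_span_pow_mul D.X htorD hcol hm
  have hm0 : m = 0 := by omega
  rw [hm0, pow_zero, one_mul] at hm
  -- the Néron-normalised generator `ϖ̃ · L^•`
  have hϖ1 : ‖(ϖ : ℚ_[p])‖ = 1 := X8_norm_periodRatio_eq_one h3 W p hX hf hϖ
  obtain ⟨hspan', hι''⟩ := span_C_units_mul_eq (PadicInt.mkUnits hϖ1) (chromaticL col Lsharp Lflat)
  refine ⟨htorD, PowerSeries.C ((PadicInt.mkUnits hϖ1 : ℤ_[p]ˣ) : ℤ_[p]) *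
    chromaticL col Lsharp Lflat, ?_, ?_⟩
  · rw [hm, hspan']
  · rw [hι'', PadicInt.mkUnits_eq]

end PerDatum

end Summit.BirchSwinnertonDyer.BirchSwinnertonDyer.Theorems.X8MainConjectureContra

end
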